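import Literature.IUT.LogThetaLattice.PacketLogVolumesRemark392Genuine
import Literature.IUT.LogThetaLattice.PacketLogVolumesHaarModelCapsulesDegree
import HarnessLib

/-!
# [IUTchIII] Remark 3.9.2 on the `A`-PACKETS (`|A| ≥ 2`): at every portion `⊗_α K_{v_α}` of abc-iut-L6-d3's
# genuine capsule model, the label-`α` action of `(†𝕄⊛_mod)_α` recovers the «nonnegative elements» at `v_α`

S. Mochizuki, *Inter-universal Teichmüller theory III*, kurims manuscript (May 2020), Remark 3.9.2, p. 119
(lit key `paper:url-4b091feeb646`) [claim: Mochizuki2012, status: disputed]: "… recovering the subquotient of the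
perfection of `(†𝕄⊛_mod)_α = (†𝕄⊛_MOD)_α` associated to `w ∈ 𝕍̲` [cf. Remark 3.6.1], together with the submonoid of
'nonnegative elements' of such a subquotient, by considering the effect of multiplication by elements of
`(†𝕄⊛_mod)_α` on the log-volumes defined on the various `𝓘^ℚ(^{A,α}𝓕_v) ≅ 𝓘^ℚ(^{A,α}𝒟^⊢_v)`" — the `α`-labelled
portions of the `A`-PACKETS `log(^A𝓕_{v_ℚ}) = ⊕_π ⊗_{α∈A} K_{v_α}` of [IUTchIII] Prop. 3.1 / Rmk. 3.1.1 (ii).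

Companion of `PacketLogVolumesRemark392Genuine.lean` (this seat, p427755: the case `|A| = 1`, absolute and relative,
with abc-iut-L6-t4's predicate `Remark392_nonnegAt` quantified over ALL subsets of one summand). HERE, `|A| ≥ 2`:
abc-iut-L6-d3's GENUINE capsule model (`PacketLogVolumesHaarModelCapsulePortions/…General/…Degree.lean`,
p418604/p419250/p419946): a portion `π = (v_α)_{α∈A}` of the `A`-packet at `v_ℚ` carries the REAL tensor packet
`⊗_{α,ℚ_p} F_{v_α}` (campaign-S `PacketAlgebra`, `μ^log = tensorLogVolume`) resp. `⊗_{α,ℝ} ℂ`, and `f ∈ F^×` acts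
through the label `α` by `ι_α(f)·(−)` with log-modulus `shift α f` on ADMISSIBLE regions (positive finite volume —
print's `𝕄(−)`; d3's one law `CapsuleDatum.logVol_act` is stated on admissible regions only, so the recovery is
read on them).

RESULTS (proof-only; every input BY NAME; nothing of L6-d3 / L6-t4 restated):
* `CapsuleDatum.forall_logVol_act_le_iff` / `…remark392_nonnegAtAdm_eq` — GENERIC over any capsule datum `D` of
  abc-iut-L6-d3 with `Nonempty D.Adm`: `{f ∈ F^× | ∀ admissible T, μ^log(f·_α T) ≤ μ^log(T)} = {f | D.shift α f ≤ 0}`;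
  `…remark392_nonnegAt_subset` — L6-t4's all-subsets set `Remark392_nonnegAt (D.act α) D.logVol` is contained in it.
* `placeLogModulus_nonpos_iff` — d3's dimension-normalised log-modulus `θ_v(f)` (`log|f|_w`, resp.
  `(1/n_v)·log‖f‖_v`) is `≤ 0` iff `‖f‖_v ≤ 1`.
* **`remark392_portion_eq`** — at EVERY portion `π` of the genuine `A`-packet at `v_ℚ` (`2 ≤ |A|`) and every label
  `α`: the recovered set is `{f ∈ F^× | ‖f‖_{v_α} ≤ 1}`, `v_α = π(α)` — it depends only on the place in the slot `α`
  (d3's `portionDatum_shift`: the shift IS `θ_{π(α)}(f)`); **`remark392_portion_eq_placeDatum`** — it COINCIDES with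
  the `|A| = 1` recovered set of the summand `F_{v_α}` (`remark392_nonnegAt_placeDatum`, p427755), hence
  **`remark392_portion_inr`** `= {f | 0 ≤ ord_{v_α}(f)}` when `π(α)` is the finite place `v_α` (print's «nonnegative
  elements»), `remark392_portion_inl` `= {f | |f|_w ≤ 1}` at an archimedean slot; and it is closed under `1`, `*`
  (`remark392_portion_one_mem/_mul_mem`, from d3's `logVol_act` additivity of shifts — no volume computation).

HONEST SCOPE. `K = F_mod = F` (d3's absolute capsules); the RELATIVE `A`-packets (`K ⊋ F_mod`, abc-iut-w5-d083's
`…RelativeTensor.lean`) have per-slot shifts `[K_w:F_v]·θ_v` up to the weight bookkeeping and reduce to the `|A| = 1`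
relative statement of p427755 (`remark392_nonnegAt_relPlaceDatum_eq_below`) slot by slot — not re-typed here. Regions:
admissible ones (the law of the capsule datum); `|A| ≥ 2` (d3's `capsuleIdealRegionAt` supplies an admissible region
at every portion; `|A| = 1` is p427755). Classical mathematics (Haar moduli of tensor packets); nothing here constructs
`(†𝓕⊛_mod)_α`, bears on the disputed [IUTchIII] Cor. 3.12, or takes a side; typed ≠ endorsed.
[cite: MochizukiAbsTopIII2015, Prop. 5.7 (i)(b) p. 138]
-/

noncomputable section

namespace Literature.IUT.LogThetaLattice

open Literature.IUT.LogVolume NumberField IsDedekindDomain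

/-! ### Generic over a capsule datum of abc-iut-L6-d3 -/

namespace CapsuleDatum

variable {F : Type} [Field F] {A : Type} (D : CapsuleDatum F A)

/-- On admissible regions, `f` acting through the label `α` never increases `μ^log` iff its shift is `≤ 0`
(`μ^log(f·_α T) = μ^log(T) + shift α f`, d3's law; one admissible region detects a positive shift).
[claim: Mochizuki2012, status: disputed] -/
theorem forall_logVol_act_le_iff (α : A) (f : Fˣ) (hT : Nonempty D.Adm) :
    (∀ T : D.Adm, D.logVol (D.act α f T.1) ≤ D.logVol T.1) ↔ D.shift α f ≤ 0 := by
  constructor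
  · intro h
    obtain ⟨T⟩ := hT
    have hle := h T
    rw [D.logVol_act α f T.1 T.2] at hle
    linarith
  · intro h T
    rw [D.logVol_act α f T.1 T.2]
    linarith

/-- **[IUTchIII] Remark 3.9.2 over a capsule datum (generic form)**: the set of `f ∈ F^×` whose `α`-action increases
no log-volume of an ADMISSIBLE region is `{f | shift α f ≤ 0}`. [claim: Mochizuki2012, status: disputed] -/
theorem remark392_nonnegAtAdm_eq (α : A) (hT : Nonempty D.Adm) :
    {f : Fˣ | ∀ T : D.Adm, D.logVol (D.act α f T.1) ≤ D.logVol T.1} = {f : Fˣ | D.shift α f ≤ 0} := by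
  ext f
  exact D.forall_logVol_act_le_iff α f hT

/-- abc-iut-L6-t4's ALL-SUBSETS recovered set `Remark392_nonnegAt (D.act α) D.logVol` is contained in the
admissible-regions recovered set (it quantifies over more regions). [claim: Mochizuki2012, status: disputed] -/
theorem remark392_nonnegAt_subset (α : A) :
    Remark392_nonnegAt (D.act α) D.logVol ⊆ {f : Fˣ | ∀ T : D.Adm, D.logVol (D.act α f T.1) ≤ D.logVol T.1} := by
  intro f hf
  simp only [Remark392_nonnegAt, Set.mem_setOf_eq] at hf ⊢
  exact fun T => hf T.1

/-- The admissible-regions recovered set contains `1` and is closed under `*` whenever the shift is a monoid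
homomorphism in `f` (`shift α 1 = 0`, `shift α (fg) = shift α f + shift α g`) — no volume computation needed.
[claim: Mochizuki2012, status: disputed] -/
theorem remark392_nonnegAtAdm_one_mem_mul_mem (α : A) (hT : Nonempty D.Adm) (h1 : D.shift α 1 = 0)
    (hmul : ∀ f g : Fˣ, D.shift α (f * g) = D.shift α f + D.shift α g) {f g : Fˣ}
    (hf : f ∈ {f : Fˣ | ∀ T : D.Adm, D.logVol (D.act α f T.1) ≤ D.logVol T.1})
    (hg : g ∈ {f : Fˣ | ∀ T : D.Adm, D.logVol (D.act α f T.1) ≤ D.logVol T.1}) :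
    (1 : Fˣ) ∈ {f : Fˣ | ∀ T : D.Adm, D.logVol (D.act α f T.1) ≤ D.logVol T.1} ∧
      f * g ∈ {f : Fˣ | ∀ T : D.Adm, D.logVol (D.act α f T.1) ≤ D.logVol T.1} := by
  rw [D.remark392_nonnegAtAdm_eq α hT, Set.mem_setOf_eq] at hf hg ⊢
  rw [Set.mem_setOf_eq, h1, hmul]
  exact ⟨le_rfl, by linarith⟩

end CapsuleDatum

/-! ### The genuine `A`-packets of abc-iut-L6-d3 (`|A| ≥ 2`) -/

section Genuine

variable (F : Type) [Field F] [NumberField F]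
variable (A : Type) [Fintype A] [DecidableEq A] [Nonempty A]

/-- d3's dimension-normalised log-modulus `θ_v(f)` is `≤ 0` iff `‖f‖_v ≤ 1` (`log|f|_w ≤ 0 ⟺ |f|_w ≤ 1`;
`(1/n_v)·log‖f‖_v ≤ 0 ⟺ ‖f‖_v ≤ 1`, `n_v > 0`). [claim: Mochizuki2012, status: disputed] -/
theorem placeLogModulus_nonpos_iff (f : Fˣ) (v : Place F) :
    placeLogModulus F f v ≤ 0 ↔ (placeDatum F v).modulus (f : F) ≤ 1 := by
  rcases v with w | v
  · show Real.log (w (f : F)) ≤ 0 ↔ w (f : F) ≤ 1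
    exact Real.log_nonpos_iff (apply_nonneg w (f : F))
  · show Real.log (NumberField.HeightOneSpectrum.adicAbv F v (f : F)) / localDegree F v ≤ 0 ↔
      NumberField.HeightOneSpectrum.adicAbv F v (f : F) ≤ 1
    have hn : (0 : ℝ) < localDegree F v := by exact_mod_cast localDegree_pos F v
    rw [div_le_iff₀ hn, zero_mul]
    exact Real.log_nonpos_iff ((NumberField.HeightOneSpectrum.adicAbv F v).nonneg _)

/-- d3's shift is a monoid homomorphism in `f`: `θ_v(1) = 0`. [claim: Mochizuki2012, status: disputed] -/
theorem placeLogModulus_one (v : Place F) : placeLogModulus F 1 v = 0 := by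
  rcases v with w | v
  · show Real.log (w ((1 : Fˣ) : F)) = 0
    rw [Units.val_one, map_one, Real.log_one]
  · show Real.log (NumberField.HeightOneSpectrum.adicAbv F v ((1 : Fˣ) : F)) / localDegree F v = 0
    rw [Units.val_one, map_one, Real.log_one, zero_div]

/-- d3's shift is a monoid homomorphism in `f`: `θ_v(fg) = θ_v(f) + θ_v(g)`. [claim: Mochizuki2012, status: disputed] -/
theorem placeLogModulus_mul (f g : Fˣ) (v : Place F) :
    placeLogModulus F (f * g) v = placeLogModulus F f v + placeLogModulus F g v := by
  rcases v with w | v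
  · show Real.log (w ((f * g : Fˣ) : F)) = Real.log (w (f : F)) + Real.log (w (g : F))
    rw [Units.val_mul, map_mul,
      Real.log_mul ((map_ne_zero w).mpr f.ne_zero) ((map_ne_zero w).mpr g.ne_zero)]
  · show Real.log (NumberField.HeightOneSpectrum.adicAbv F v ((f * g : Fˣ) : F)) / localDegree F v =
      Real.log (NumberField.HeightOneSpectrum.adicAbv F v (f : F)) / localDegree F v +
        Real.log (NumberField.HeightOneSpectrum.adicAbv F v (g : F)) / localDegree F v
    rw [Units.val_mul, map_mul, Real.log_mul ((NumberField.HeightOneSpectrum.adicAbv F v).pos f.ne_zero).ne'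
      ((NumberField.HeightOneSpectrum.adicAbv F v).pos g.ne_zero).ne', add_div]

variable (hA : 2 ≤ Fintype.card A)
include hA

/-- Every portion of the genuine `A`-packet (`|A| ≥ 2`) carries an admissible region (d3's `capsuleIdealRegionAt` of
the unit family). [claim: Mochizuki2012, status: disputed] -/
theorem nonempty_adm_portionDatum (q : RatPlace) (π : Portion F A q) : Nonempty (portionDatum F A q π).Adm :=
  ⟨capsuleIdealRegionAt F A hA (Classical.arbitrary A) IdealFamily.unit q π⟩

/-- **[IUTchIII] Remark 3.9.2 on the `A`-packets (`|A| ≥ 2`), every `v_ℚ`, every portion `π = (v_α)_α`, every label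
`α`**: the set of `f ∈ F^×` whose label-`α` multiplication `ι_α(f)·(−)` increases no log-volume of an admissible
region of `⊗_α F_{v_α}` is `{f | ‖f‖_{v_α} ≤ 1}` — it depends only on the place `v_α = π(α)` in the slot `α`.
[claim: Mochizuki2012, status: disputed] -/
theorem remark392_portion_eq (q : RatPlace) (π : Portion F A q) (α : A) :
    {f : Fˣ | ∀ T : (portionDatum F A q π).Adm,
        (portionDatum F A q π).logVol ((portionDatum F A q π).act α f T.1) ≤ (portionDatum F A q π).logVol T.1} =
      {f : Fˣ | (placeDatum F (π α).1).modulus (f : F) ≤ 1} := by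
  rw [(portionDatum F A q π).remark392_nonnegAtAdm_eq α (nonempty_adm_portionDatum F A hA q π)]
  ext f
  simp only [Set.mem_setOf_eq, portionDatum_shift]
  exact placeLogModulus_nonpos_iff F f (π α).1

/-- **It COINCIDES with the `|A| = 1` recovered set of the summand at `v_α`** (p427755's
`remark392_nonnegAt_placeDatum`, abc-iut-L6-t4's predicate over all subsets of `F_{v_α}`): the `A`-packets recover
nothing new and nothing less, slot by slot. [claim: Mochizuki2012, status: disputed] -/
theorem remark392_portion_eq_placeDatum (q : RatPlace) (π : Portion F A q) (α : A) :
    {f : Fˣ | ∀ T : (portionDatum F A q π).Adm,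
        (portionDatum F A q π).logVol ((portionDatum F A q π).act α f T.1) ≤ (portionDatum F A q π).logVol T.1} =
      Remark392_nonnegAt (fun (f : Fˣ) (S : Set (placeDatum F (π α).1).X) => (placeDatum F (π α).1).act (f : F) S)
        (placeDatum F (π α).1).logVol := by
  rw [remark392_portion_eq F A hA, remark392_nonnegAt_placeDatum]

/-- **At a portion whose slot `α` is a FINITE place `v`: the recovered set is `{f ∈ F^× | 0 ≤ ord_v(f)}`** — print's
«submonoid of nonnegative elements» at `v`, read on the `α`-labelled portion of the `A`-packet.
[claim: Mochizuki2012, status: disputed] -/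
theorem remark392_portion_inr (q : RatPlace) (π : Portion F A q) (α : A) (v : HeightOneSpectrum (𝓞 F))
    (hv : (π α).1 = Sum.inr v) :
    {f : Fˣ | ∀ T : (portionDatum F A q π).Adm,
        (portionDatum F A q π).logVol ((portionDatum F A q π).act α f T.1) ≤ (portionDatum F A q π).logVol T.1} =
      {f : Fˣ | 0 ≤ ord F v (f : F)} := by
  rw [remark392_portion_eq F A hA, hv]
  ext f
  simp only [Set.mem_setOf_eq, placeDatum_inr, nonarchDatum_modulus]
  exact adicAbv_le_one_iff_ord_nonneg F v f.ne_zero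

/-- At a portion whose slot `α` is an ARCHIMEDEAN place `w`: the recovered set is `{f | |f|_w ≤ 1}`.
[claim: Mochizuki2012, status: disputed] -/
theorem remark392_portion_inl (q : RatPlace) (π : Portion F A q) (α : A) (w : InfinitePlace F)
    (hw : (π α).1 = Sum.inl w) :
    {f : Fˣ | ∀ T : (portionDatum F A q π).Adm,
        (portionDatum F A q π).logVol ((portionDatum F A q π).act α f T.1) ≤ (portionDatum F A q π).logVol T.1} =
      {f : Fˣ | w (f : F) ≤ 1} := by
  rw [remark392_portion_eq F A hA, hw]
  rfl

/-- (4) on the `A`-packets: at every portion and label the recovered set contains `1` and is closed under `*` —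
the «submonoid of nonnegative elements» (from the additivity of d3's shifts; no volume computation).
[claim: Mochizuki2012, status: disputed] -/
theorem remark392_portion_one_mem_mul_mem (q : RatPlace) (π : Portion F A q) (α : A) {f g : Fˣ}
    (hf : f ∈ {f : Fˣ | ∀ T : (portionDatum F A q π).Adm,
      (portionDatum F A q π).logVol ((portionDatum F A q π).act α f T.1) ≤ (portionDatum F A q π).logVol T.1})
    (hg : g ∈ {f : Fˣ | ∀ T : (portionDatum F A q π).Adm,
      (portionDatum F A q π).logVol ((portionDatum F A q π).act α f T.1) ≤ (portionDatum F A q π).logVol T.1}) :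
    (1 : Fˣ) ∈ {f : Fˣ | ∀ T : (portionDatum F A q π).Adm,
        (portionDatum F A q π).logVol ((portionDatum F A q π).act α f T.1) ≤ (portionDatum F A q π).logVol T.1} ∧
      f * g ∈ {f : Fˣ | ∀ T : (portionDatum F A q π).Adm,
        (portionDatum F A q π).logVol ((portionDatum F A q π).act α f T.1) ≤ (portionDatum F A q π).logVol T.1} :=
  (portionDatum F A q π).remark392_nonnegAtAdm_one_mem_mul_mem α (nonempty_adm_portionDatum F A hA q π)
    (by rw [portionDatum_shift, placeLogModulus_one])
    (fun f g => by rw [portionDatum_shift, portionDatum_shift, portionDatum_shift, placeLogModulus_mul]) hf hg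

/-- L6-t4's all-subsets recovered set at a portion is contained in the one above (and at `|A| = 1` it equals the
place-datum set, p427755). [claim: Mochizuki2012, status: disputed] -/
theorem remark392_nonnegAt_portion_subset (q : RatPlace) (π : Portion F A q) (α : A) :
    Remark392_nonnegAt ((portionDatum F A q π).act α) (portionDatum F A q π).logVol ⊆
      {f : Fˣ | (placeDatum F (π α).1).modulus (f : F) ≤ 1} := by
  rw [← remark392_portion_eq F A hA]
  exact (portionDatum F A q π).remark392_nonnegAt_subset α

end Genuine

end Literature.IUT.LogThetaLattice

end
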